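import Summits.BirchSwinnertonDyer.BirchSwinnertonDyer.Theorems.QuadraticBranchSignedControlEtaLayerClassical
import Summits.BirchSwinnertonDyer.Rank1Residual.Additive.ZpTowerSeam
import Literature.NumberTheory.EllipticCurves.SelmerCorankProofs
import Literature.NumberTheory.EllipticCurves.SelmerCorankControlCoinvariantsProofs
import Literature.NumberTheory.EllipticCurves.SelmerGroupOverTorsionFinite
import HarnessLib

/-!
# Route `AlignedTransportAtTwo`, crux C2 `MainConjectureOfRankZeroBSDAtTwo` (stmt-BirchSwinnertonDyer-22298):
# THE LAYER SELMER GROUP IS THE SELMER GROUP OF THE LAYER —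
# `Sel_{p^∞}(E_{K_n}/K_n)` of file `Selmer` `≃` `W.selmerLayer κ n` (`Γ_K`-internal), for EVERY number field `K`,
# EVERY `ℤ_p`-extension `κ`, EVERY layer `n`, EVERY Weierstrass curve `W/K`

HONEST FRAMING (cell `bsd-f1-sign2`, WIDTH-5 attached prover seat `bsd-line-att-p5` gen 39 on line `birth` of the lead
`bsd-line-att-p2`; `--supports` stmt-BirchSwinnertonDyer-22298, closes nothing; BSD is NOT proved by any of this; the crux
C2, its verdict «blocked-on `Rank1Residual.GreenbergMuConjectureIrreducible`» and every registered stub are untouched).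
THEOREMS ONLY — no `def`, no instance, no named fact, no `sorry`. INFRASTRUCTURE (Galois-cohomological bookkeeping,
Greenberg LNM 1716 §2 / Mazur 1972 §6: "`Sel_E(M)_p`" for an algebraic extension `M/F` is defined by local conditions at
ALL primes of `M`, the groups `G_{M_η}` being decomposition groups of primes of `F̄`): the «Selmer-layer model
identification» recorded as INFRASTRUCTURE WANT #1 by the lineage (g38 HANDOFF NET (4); also wanted by cells `bsd-2adic`
(t42 Stage B) and `bsd-rank2` (Greenberg Thm. 1.9, Selmer clause)). NOTHING new is constructed: the two inclusions of the
place bookkeeping are cell `bsd-potss`' `EtaLayer.map_subgroupH1Iso_selmerGroupOver` (file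
`QuadraticBranchSignedControlEtaLayerClassical`: every `K`-embedding `K̄ → K̄_v` / `L`-embedding `L̄ → L̄_w` has a local package
at some `w ∣ v`, finite AND infinite places), the top bridge is the tree's `SubgroupSelmerProofs` (run here at a level
`S ∋` everything instead of `⊤`), and the seam `galRange K_n = κ⁻¹(pⁿℤ_p)` is cell `b2b-bsdres`'
`ZpTower.galRange_layer_eq_layerSubgroup`.

* §1 (any field `K`, `W/K`, `p`, a subgroup `S ≤ Γ_K` containing every element): `localResOver_resH1Hom_subgroupIncl`,
  `resH1Hom_subgroupIncl_mem_localKerOver_iff`, `resH1Hom_subgroupIncl_mem_selmerGroupOver_iff`,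
  ★ `exists_addEquiv_selmerGroupPInfty_selmerGroupOver_of_forall_mem` — `Sel_{p^∞}(E/K) ≃+ W.selmerGroupOver p S` along the
  (bijective) restriction `res_S : H¹(Γ_K, E[p^∞]) → H¹(S, E[p^∞])` (the tree's `selmerGroupOver_top`, `S = ⊤`, verbatim at `S`).
* §2 (number fields `K ⊆ L`, `L/K` Galois, `U ≤ galRange L` normal in `Γ_K` with `res⁻¹ U = Γ_L`):
  ★★ `exists_addEquiv_selmerGroupPInfty_baseChange_selmerGroupOver` — **`Sel_{p^∞}(E_L/L) ≃+ W.selmerGroupOver p U`**, on classes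
  `c ↦ subgroupH1Iso (res_{res⁻¹U} c)`; the case `U = galRange L` (`…_galRange`).
* §3 (a `ℤ_p`-extension `κ` of a number field `K`, any `n`): ★★★ `exists_addEquiv_selmerGroupPInfty_layer_selmerLayer` —
  **`Sel_{p^∞}(E_{K_n}/K_n) ≃+ W.selmerLayer κ n`** (`K_n = κ.layer n` with its number-field structure
  `ZpExtension.numberField_layer`; `U = κ.layerSubgroup n = galRange K_n`), and `nonempty_addEquiv_selmerLayer`.
* §4 consequences: ★★ `selmerCorank_layer_eq_zpCorank_selmerLayer` — `corank_{ℤ_p} Sel_{p^∞}(E_{K_n}/K_n) = corank_{ℤ_p}` of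
  the `Γ_K`-internal layer Selmer group; `natCard_torsionBy_selmerLayer_eq` / `finite_torsionBy_selmerGroupPInfty_layer`
  (the `p^k`-torsion subgroups correspond; finiteness of `Sel_{p^∞}(E_{K_n}/K_n)[p]` read off the open subgroup `κ⁻¹(pⁿℤ_p)`).

References: R. Greenberg, LNM 1716 (1999), §2 (pp. 70–72: `Sel_E(M)_p` for `M/F` algebraic, all primes `η` of `M`) and
§3 (the maps `Sel_E(F_n)_p → Sel_E(F_∞)_p^{Γ_n}`) [GreenbergLNM1716]; B. Mazur, Invent. Math. 18 (1972), §6 [Mazur1972];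
J.-P. Serre, *Galois Cohomology* (1997), I.§2.4–2.5, II.§1.1 [SerreGaloisCohomology1997]; J. Neukirch, *Algebraic Number
Theory* (1999), II.§8 (`L ⊗_K K_v = ∏_{w∣v} L_w`) [NeukirchANT1999]; L. Washington, GTM 83, §13.1 [Washington1997].
-/

set_option linter.dupNamespace false
set_option autoImplicit false

noncomputable section

open scoped Classical AddSubgroup

universe u

namespace Summit.BirchSwinnertonDyer.BirchSwinnertonDyer.Theorems.AlignedTransportAtTwoSelmerLayerModel

open NumberField IsDedekindDomain WeierstrassCurve Literature.NumberTheory.EllipticCurves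
  Summit.BirchSwinnertonDyer.Rank1Residual.Additive.BaseChange
  Summit.BirchSwinnertonDyer.Rank1Residual.Additive.ZpTower
  Summit.BirchSwinnertonDyer.BirchSwinnertonDyer.Theorems.EtaLayer

/-! ## §1 The Selmer group of file `Selmer` at a level `S ≤ Γ_K` containing every element -/

section Forall

variable {K : Type u} [Field K] (W : WeierstrassCurve K) (p : ℕ) (S : Subgroup (Field.absoluteGaloisGroup K))
  (hS : ∀ g : Field.absoluteGaloisGroup K, g ∈ S)

/-- **The local restriction over `S` after `res_S : H¹(Γ_K, ·) → H¹(S, ·)`.** For `c ∈ H¹(K, E[p^∞])`, the local restriction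
`localResOver p S E` of `res_S c` is the restriction to the local subgroup `(Γ_E → Γ_K)⁻¹(S) ≤ Γ_E` of the image of `c` in
`H¹(Γ_E, E(K̄_E))` — both are the map of one compatible pair (functoriality; the tree's `localResOver_top_resH1Hom_subgroupIncl`
verbatim at `S`). [cite: SerreGaloisCohomology1997, I.§2.4] [cite: GreenbergLNM1716, §2] -/
theorem localResOver_resH1Hom_subgroupIncl {E : Type u} [Field E] [Algebra K E] (c : W.galH1Primary p) :
    W.localResOver p S E
        (resH1Hom (subgroupIncl S) (AddMonoidHom.id (geomPrimaryTorsion W p)) (fun _ _ ↦ rfl) c) =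
      resH1Hom (subgroupIncl (localSubgroup S E)) (AddMonoidHom.id (localPoints W E)) (fun _ _ ↦ rfl)
        (resH1Hom (resGal (K := K) E) ((pointsMap W E).comp (geomPrimaryTorsion W p).subtype)
          (W.pointsMap_comp_subtype_smul p) c) := by
  show resH1Hom (resGalSubgroupOfEmb S (closureEmb (K := K) E))
      ((pointsMapOfEmb W (closureEmb (K := K) E)).comp (geomPrimaryTorsion W p).subtype)
      (W.pointsMapOfEmb_comp_subtype_smul p (closureEmb (K := K) E) S)
      (resH1Hom (subgroupIncl S) (AddMonoidHom.id (geomPrimaryTorsion W p)) (fun _ _ ↦ rfl) c) = _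
  rw [resH1Hom_resH1Hom, resH1Hom_resH1Hom]
  exact DFunLike.congr_fun (resH1Hom_congr (by ext; rfl) (by ext; rfl) _ _) c

include hS in
/-- **The local kernels over `S ∋` everything are the local kernels of file `Selmer`**: `res_S c` dies in
`H¹((Γ_E → Γ_K)⁻¹(S), E(K̄_E))` iff `c` dies in `H¹(Γ_E, E(K̄_E))` (the local subgroup contains every element of `Γ_E`, so
restriction to it is injective, `resH1Hom_subgroupIncl_eq_zero_iff`). [cite: GreenbergLNM1716, §2] -/
theorem resH1Hom_subgroupIncl_mem_localKerOver_iff {E : Type u} [Field E] [Algebra K E] (c : W.galH1Primary p) :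
    resH1Hom (subgroupIncl S) (AddMonoidHom.id (geomPrimaryTorsion W p)) (fun _ _ ↦ rfl) c ∈ W.localKerOver p S E ↔
      c ∈ selmerLocalKerPrimary W E p := by
  rw [mem_localKerOver_iff, localResOver_resH1Hom_subgroupIncl,
    resH1Hom_subgroupIncl_eq_zero_iff _ _ (fun τ ↦ (mem_localSubgroup_iff S E τ).mpr (hS _)),
    mem_selmerLocalKerPrimary_iff]

include hS in
/-- **Membership correspondence at level `S`.** For `c ∈ H¹(K, E[p^∞])` and `S ≤ Γ_K` (normal) containing every element,
`res_S c ∈ W.selmerGroupOver p S` iff `c ∈ Sel_{p^∞}(E/K)`: every `conj_σ`, `σ ∈ S`, is the identity on `H¹(S, ·)`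
(`conjH1_of_mem_holds`), and the local kernels correspond (`resH1Hom_subgroupIncl_mem_localKerOver_iff`).
[cite: GreenbergLNM1716, §2] [cite: Mazur1972, §6] -/
theorem resH1Hom_subgroupIncl_mem_selmerGroupOver_iff [NumberField K] [S.Normal] (c : W.galH1Primary p) :
    resH1Hom (subgroupIncl S) (AddMonoidHom.id (geomPrimaryTorsion W p)) (fun _ _ ↦ rfl) c ∈ W.selmerGroupOver p S ↔
      c ∈ selmerGroupPInfty W p := by
  have hconj : ∀ σ : Field.absoluteGaloisGroup K,
      W.conjH1 p S σ (resH1Hom (subgroupIncl S) (AddMonoidHom.id (geomPrimaryTorsion W p)) (fun _ _ ↦ rfl) c) =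
        resH1Hom (subgroupIncl S) (AddMonoidHom.id (geomPrimaryTorsion W p)) (fun _ _ ↦ rfl) c := fun σ ↦ by
    rw [W.conjH1_of_mem_holds p S (hS σ), AddMonoidHom.id_apply]
  rw [mem_selmerGroupOver_iff, selmerGroupPInfty, AddSubgroup.mem_inf, AddSubgroup.mem_iInf, AddSubgroup.mem_iInf]
  simp only [hconj, resH1Hom_subgroupIncl_mem_localKerOver_iff W p S hS, forall_const]

include hS in
/-- ★ **`Sel_{p^∞}(E/K) ≃+ W.selmerGroupOver p S` for `S ∋` everything**, explicitly: the restriction `res_S` is bijective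
(`bijective_resH1Hom_subgroupIncl`) and carries `Sel_{p^∞}(E/K)` onto `W.selmerGroupOver p S`; the isomorphism is
`AddEquiv.ofBijective res_S` restricted (the tree's `exists_addEquiv_selmerGroupOver_top` at `S` instead of `⊤`).
[cite: GreenbergLNM1716, §2] -/
theorem exists_addEquiv_selmerGroupPInfty_selmerGroupOver_of_forall_mem [NumberField K] [S.Normal] :
    ∃ f : W.selmerGroupPInfty p ≃+ W.selmerGroupOver p S,
      ∀ c : W.selmerGroupPInfty p, ((f c : W.selmerGroupOver p S) : W.subgroupH1 p S) =
        resH1Hom (subgroupIncl S) (AddMonoidHom.id (geomPrimaryTorsion W p)) (fun _ _ ↦ rfl) (c : W.galH1Primary p) := by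
  let e : W.galH1Primary p ≃+ W.subgroupH1 p S :=
    AddEquiv.ofBijective (resH1Hom (subgroupIncl S) (AddMonoidHom.id (geomPrimaryTorsion W p)) (fun _ _ ↦ rfl))
      (bijective_resH1Hom_subgroupIncl _ S hS)
  have he : ∀ c : W.galH1Primary p,
      e c = resH1Hom (subgroupIncl S) (AddMonoidHom.id (geomPrimaryTorsion W p)) (fun _ _ ↦ rfl) c := fun _ ↦ rfl
  have h : (selmerGroupPInfty W p).map (e : W.galH1Primary p →+ W.subgroupH1 p S) = W.selmerGroupOver p S := by
    ext y
    rw [AddSubgroup.mem_map]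
    constructor
    · rintro ⟨c, hc, rfl⟩
      exact (resH1Hom_subgroupIncl_mem_selmerGroupOver_iff W p S hS c).mpr hc
    · intro hy
      refine ⟨e.symm y, ?_, e.apply_symm_apply y⟩
      rw [← resH1Hom_subgroupIncl_mem_selmerGroupOver_iff W p S hS, ← he, e.apply_symm_apply]
      exact hy
  exact ⟨(e.addSubgroupMap _).trans (AddEquiv.addSubgroupCongr h), fun _ ↦ rfl⟩

end Forall

/-! ## §2 `Sel_{p^∞}(E_L/L) ≃ W.selmerGroupOver p U` for `L/K` Galois, `U ≤ galRange L` with `res⁻¹ U = Γ_L` -/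

section BaseChange

variable {K : Type u} [Field K] [NumberField K] (L : Type u) [Field L] [NumberField L] [Algebra K L] [IsGalois K L]
  (W : WeierstrassCurve K) (p : ℕ) {U : Subgroup (Field.absoluteGaloisGroup K)} [U.Normal]
  (hU : U ≤ galRange (K := K) L) (hS : ∀ σ : Field.absoluteGaloisGroup L, σ ∈ comapResGal L U)

include hS in
/-- ★★ **`Sel_{p^∞}(E_L/L) ≃+ W.selmerGroupOver p U`** for number fields `K ⊆ L` with `L/K` Galois and a normal subgroup
`U ≤ galRange L` of `Γ_K` with `res⁻¹ U = Γ_L` (i.e. `U` cuts out `L`): the `p^∞`-Selmer group of the base change `E_L` over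
the number field `L` (file `Selmer`: local conditions at the places of `L`) is, along
`c ↦ subgroupH1Iso (res_{res⁻¹U} c)`, the `Γ_K`-internal Selmer group `W.selmerGroupOver p U ⊆ H¹(U, E[p^∞])` (file
`SubgroupSelmer`: local conditions at the places of `K`, all `Γ_K`-conjugates). §1 at `S = res⁻¹ U ≤ Γ_L` followed by cell
`bsd-potss`' `EtaLayer.map_subgroupH1Iso_selmerGroupOver`. [cite: GreenbergLNM1716, §2] [cite: Mazur1972, §6]
[cite: SerreGaloisCohomology1997, II.§1.1] -/
theorem exists_addEquiv_selmerGroupPInfty_baseChange_selmerGroupOver :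
    ∃ Φ : (W.baseChange L).selmerGroupPInfty p ≃+ W.selmerGroupOver p U,
      ∀ c : (W.baseChange L).selmerGroupPInfty p, ((Φ c : W.selmerGroupOver p U) : W.subgroupH1 p U) =
        subgroupH1Iso L W p hU
          (resH1Hom (subgroupIncl (comapResGal L U)) (AddMonoidHom.id (geomPrimaryTorsion (W.baseChange L) p))
            (fun _ _ ↦ rfl) (c : (W.baseChange L).galH1Primary p)) := by
  obtain ⟨f, hf⟩ :=
    exists_addEquiv_selmerGroupPInfty_selmerGroupOver_of_forall_mem (W.baseChange L) p (comapResGal L U) hS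
  have h := map_subgroupH1Iso_selmerGroupOver L W p hU
  refine ⟨f.trans (((subgroupH1Iso L W p hU).addSubgroupMap _).trans (AddEquiv.addSubgroupCongr h)), fun c ↦ ?_⟩
  rw [← hf c]
  rfl

omit hS in
/-- The case `U = galRange L` (`res⁻¹(galRange L) = Γ_L` tautologically; `galRange L` is normal for `L/K` Galois, e.g. the tree's
`normal_galRange_of_normal`): **`Sel_{p^∞}(E_L/L) ≃+ W.selmerGroupOver p (galRange L)`**.
[cite: GreenbergLNM1716, §2] [cite: Mazur1972, §6] -/
theorem exists_addEquiv_selmerGroupPInfty_baseChange_selmerGroupOver_galRange [(galRange (K := K) L).Normal] :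
    ∃ Φ : (W.baseChange L).selmerGroupPInfty p ≃+ W.selmerGroupOver p (galRange (K := K) L),
      ∀ c : (W.baseChange L).selmerGroupPInfty p,
        ((Φ c : W.selmerGroupOver p (galRange (K := K) L)) : W.subgroupH1 p (galRange (K := K) L)) =
        subgroupH1Iso L W p le_rfl
          (resH1Hom (subgroupIncl (comapResGal L (galRange (K := K) L)))
            (AddMonoidHom.id (geomPrimaryTorsion (W.baseChange L) p))
            (fun _ _ ↦ rfl) (c : (W.baseChange L).galH1Primary p)) :=
  exists_addEquiv_selmerGroupPInfty_baseChange_selmerGroupOver L W p le_rfl fun σ ↦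
    (mem_comapResGal_iff L _ σ).mpr ⟨σ, rfl⟩

end BaseChange

/-! ## §3 The layers of a `ℤ_p`-extension: `Sel_{p^∞}(E_{K_n}/K_n) ≃ W.selmerLayer κ n` -/

section Layer

variable {K : Type u} [Field K] [NumberField K] (W : WeierstrassCurve K) {p : ℕ} [Fact p.Prime]
  (κ : ZpExtension K p) (n : ℕ)

/-- The seam, as an inclusion: `κ⁻¹(pⁿℤ_p) ≤ galRange K_n` (`ZpTower.galRange_layer_eq_layerSubgroup`).
[cite: Washington1997, §13.1] -/
theorem layerSubgroup_le_galRange_layer : κ.layerSubgroup n ≤ galRange (K := K) (κ.layer n) :=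
  (galRange_layer_eq_layerSubgroup κ n).ge

/-- The seam, as `res⁻¹(κ⁻¹(pⁿℤ_p)) = Γ_{K_n}`: every `τ ∈ Γ_{K_n}` restricts into the layer subgroup.
[cite: Washington1997, §13.1] -/
theorem mem_comapResGal_layerSubgroup (τ : Field.absoluteGaloisGroup (κ.layer n)) :
    τ ∈ comapResGal (κ.layer n) (κ.layerSubgroup n) := by
  rw [mem_comapResGal_iff, ← galRange_layer_eq_layerSubgroup κ n]
  exact ⟨τ, rfl⟩

/-- ★★★ **THE LAYER SELMER GROUP IS THE SELMER GROUP OF THE LAYER.** For a number field `K`, a Weierstrass curve `W/K`,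
a prime `p`, a `ℤ_p`-extension `κ` of `K` and `n : ℕ`: the `p^∞`-Selmer group `Sel_{p^∞}(E_{K_n}/K_n)` of the base change of
`W` to the layer number field `K_n = κ.layer n` (file `Selmer`, local conditions at the places of `K_n` — the object of
Dokchitser–Dokchitser 4.14, Kato 14.3/17.4 over `K_n`, `BSDp` over `K_n`) is isomorphic to the `Γ_K`-internal layer Selmer
group `W.selmerLayer κ n = W.selmerGroupOver p (κ⁻¹(pⁿℤ_p)) ⊆ H¹(κ⁻¹(pⁿℤ_p), E[p^∞])` (file `IwasawaSelmer`, the object of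
Mazur's control theorem `selmer_control` and of Greenberg's Lemma 3.1), along `c ↦ subgroupH1Iso (res c)`.
[cite: GreenbergLNM1716, §2 and §3] [cite: Mazur1972, §6] [cite: Washington1997, §13.1] -/
theorem exists_addEquiv_selmerGroupPInfty_layer_selmerLayer :
    ∃ Φ : (W.baseChange (κ.layer n)).selmerGroupPInfty p ≃+ W.selmerLayer κ n,
      ∀ c : (W.baseChange (κ.layer n)).selmerGroupPInfty p,
        ((Φ c : W.selmerLayer κ n) : W.subgroupH1 p (κ.layerSubgroup n)) =
        subgroupH1Iso (κ.layer n) W p (layerSubgroup_le_galRange_layer κ n)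
          (resH1Hom (subgroupIncl (comapResGal (κ.layer n) (κ.layerSubgroup n)))
            (AddMonoidHom.id (geomPrimaryTorsion (W.baseChange (κ.layer n)) p))
            (fun _ _ ↦ rfl) (c : (W.baseChange (κ.layer n)).galH1Primary p)) :=
  exists_addEquiv_selmerGroupPInfty_baseChange_selmerGroupOver (κ.layer n) W p (layerSubgroup_le_galRange_layer κ n)
    (mem_comapResGal_layerSubgroup κ n)

/-- `Sel_{p^∞}(E_{K_n}/K_n) ≃ W.selmerLayer κ n` (existence form). [cite: GreenbergLNM1716, §2 and §3] [cite: Mazur1972, §6] -/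
theorem nonempty_addEquiv_selmerLayer :
    Nonempty ((W.baseChange (κ.layer n)).selmerGroupPInfty p ≃+ W.selmerLayer κ n) :=
  let ⟨Φ, _⟩ := exists_addEquiv_selmerGroupPInfty_layer_selmerLayer W κ n
  ⟨Φ⟩

/-! ## §4 Consequences: coranks, torsion, finiteness -/

/-- ★★ **`corank_{ℤ_p} Sel_{p^∞}(E_{K_n}/K_n) = corank_{ℤ_p} (W.selmerLayer κ n)`** — the Selmer corank of the layer number
field (file `Selmer`, `WeierstrassCurve.selmerCorank`, as in Greenberg's Thm. 1.9 / Dokchitser–Dokchitser 4.14) is the corank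
of the `Γ_K`-internal layer Selmer group of the control theorem (`zpCorank_congr`). [cite: GreenbergLNM1716, §1 p. 63 and §3] -/
theorem selmerCorank_layer_eq_zpCorank_selmerLayer :
    (W.baseChange (κ.layer n)).selmerCorank p = zpCorank (W.selmerLayer κ n) p := by
  obtain ⟨Φ, -⟩ := exists_addEquiv_selmerGroupPInfty_layer_selmerLayer W κ n
  exact zpCorank_congr Φ p

/-- **The `m`-torsion subgroups correspond**: `#Sel_{p^∞}(E_{K_n}/K_n)[m] = #(W.selmerLayer κ n)[m]` for every `m : ℕ`
(an additive isomorphism preserves `m`-torsion; e.g. `m = p^k`, the currency of `selmer_control`). [cite: GreenbergLNM1716, §3] -/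
theorem natCard_torsionBy_selmerLayer_eq (m : ℕ) :
    Nat.card ((W.baseChange (κ.layer n)).selmerGroupPInfty p)[(m : ℤ)] = Nat.card (W.selmerLayer κ n)[(m : ℤ)] := by
  obtain ⟨Φ, -⟩ := exists_addEquiv_selmerGroupPInfty_layer_selmerLayer W κ n
  exact Nat.card_congr (torsionByEquiv Φ m).toEquiv

/-- **`Sel_{p^∞}(E_{K_n}/K_n)[p]` is finite, read off the open subgroup `κ⁻¹(pⁿℤ_p)`** (the tree's
`finite_torsionBy_selmerGroupOver` for the open normal subgroup `κ.layerSubgroup n`, transported; for an elliptic curve this is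
also `finite_torsionBy_selmerGroupPInfty` over the number field `K_n` — the point is that the two objects now agree).
[cite: GreenbergLNM1716, §1 p. 60] -/
theorem finite_torsionBy_selmerGroupPInfty_layer [W.IsElliptic] :
    Finite ((W.baseChange (κ.layer n)).selmerGroupPInfty p)[(p : ℤ)] := by
  obtain ⟨Φ, -⟩ := exists_addEquiv_selmerGroupPInfty_layer_selmerLayer W κ n
  haveI : Finite (W.selmerLayer κ n)[(p : ℤ)] :=
    W.finite_torsionBy_selmerGroupOver p (κ.layerSubgroup n) (κ.isOpen_layerSubgroup n)
  exact Finite.of_equiv _ (torsionByEquiv Φ p).toEquiv.symm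

/-- Every class of the `Γ_K`-internal layer Selmer group is `p`-power torsion (transport of
`exists_pow_smul_selmerGroupPInfty_eq_zero` over the number field `K_n`). [cite: GreenbergLNM1716, §1 p. 60] -/
theorem exists_pow_smul_selmerLayer_eq_zero (s : W.selmerLayer κ n) : ∃ k : ℕ, p ^ k • s = 0 := by
  obtain ⟨Φ, -⟩ := exists_addEquiv_selmerGroupPInfty_layer_selmerLayer W κ n
  obtain ⟨k, hk⟩ := (W.baseChange (κ.layer n)).exists_pow_smul_selmerGroupPInfty_eq_zero (Φ.symm s)
  exact ⟨k, by rw [← Φ.apply_symm_apply s, ← map_nsmul, hk, map_zero]⟩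

end Layer

end Summit.BirchSwinnertonDyer.BirchSwinnertonDyer.Theorems.AlignedTransportAtTwoSelmerLayerModel

end
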